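import Literature.NumberTheory.GaloisRepresentations.LubinTateColemanRelativeSeriesTwo
import Literature.NumberTheory.GaloisRepresentations.LubinTateColemanRelativeLogDerivTwo
import Literature.NumberTheory.GaloisRepresentations.LubinTateColemanTraceKernelTwo
import HarnessLib

/-!
# Theorem I.3.7 over an unramified base `k' = E`, power-series half (`q = 2`, `π = 2u`): the coordinate `r_β ∈ 𝒪_E⟦Y⟧` of a
# norm-coherent unit `β` along `E·K_π^{m+1}` — `(δ_E g_β)~ = (1 + u⁻¹X)·(r_β ∘ f)`

De Shalit, *Iwasawa theory of elliptic curves with complex multiplication* (1987), Ch. I §3.7, §3.12–3.14, relative situation: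
for `β ∈ 𝒰` over the unramified base `k' = E ⊆ F^{nr}` (finite Galois over `F`) with Coleman series `g_β ∈ 𝒪_E⟦X⟧^×`
(`𝒩_E g_β = g_β^φ`, `LubinTateColemanRelativeSeriesTwo`), the logarithmic derivative `h = δ_E g_β` satisfies the TWISTED
eigen-equation `𝒮_E h = π·h^φ` (`LubinTateColemanRelativeLogDerivTwo`), so `h̃ = h − u·(h^φ ∘ f)` is trace-zero
(`LubinTateColemanRelativeTildeTwo`) and hence `h̃ = (1 + u⁻¹X)·(r ∘ f)` for a unique `r ∈ 𝒪_E⟦Y⟧`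
(`LubinTateColemanRelativeKernelTwo`): the COORDINATE `r_β`.  PROVED here (0 sorry): `relLogDerivSeries` (`δβ`),
`relTraceTwo_relLogDerivSeries` (`𝒮_E(δβ) = π·(δβ)^φ`), `relLogDerivSeries_mul/one`; `relTildeSeries` and
`relTraceTwo_relTildeSeries` (`= 0`); ★ `exists_unique_relCoord` / `relUnitCoordTwo` with ★★ `relTildeSeries_eq_relUnitCoordTwo`
(`(δβ)~ = (1 + u⁻¹X)·(r_β ∘ f)`), `relUnitCoordTwo_mul` (`r_{ββ'} = r_β + r_{β'}`), `relUnitCoordTwo_one`.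

## References

* E. de Shalit, *Iwasawa theory of elliptic curves with complex multiplication* (1987), Ch. I §3.7 Theorem, §3.12–3.14. [deShalit1987]
-/

noncomputable section

open scoped PowerSeries.WithPiTopology

namespace Literature.NumberTheory.GaloisRepresentations

section RelativeCoordTwo

open GaloisRepresentations.IsNonarchimedeanLocalField LubinTate ValuativeRel Field

variable {F : Type} [Field F] [ValuativeRel F] [TopologicalSpace F] [IsNonarchimedeanLocalField F]

attribute [local instance] ltNormUniformSpace ltNormIsUniformAddGroup rk1 nF nE fintypeResidueField

variable {π : 𝒪[F]} (hπ : (valuation F).IsUniformizer (π : F))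
variable (E : IntermediateField F (AlgebraicClosure F)) [FiniteDimensional F E] [Normal F E] [IsGalois F E]
variable (hq : residueFieldCard F = 2) (hE : E ≤ maxUnramified F) {σ₀ : absoluteGaloisGroup F} (hσ₀ : IsAbsArithFrob σ₀)

/-! ### `δβ = δ_E g_β` and its twisted eigen-equation -/

/-- **`δβ := δ_E(g_β)`**, the logarithmic derivative of the relative Coleman series of `β`. [cite: deShalit1987, Ch. I §3.12] -/
def relLogDerivSeries (β : RelNormCoherentUnits hπ E) : PowerSeries (unitBall E) :=
  relLogDeriv hπ E (isUnit_relColemanSeries hπ E hq hE hσ₀ β).unit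

omit [IsGalois F E] in
/-- The Frobenius of `𝒪_E` fixes the coefficient ring `𝒪_F`. [cite: deShalit1987, Ch. I §1.1] -/
theorem frobUnitBall_algebraMap_LTCoeff (σ₀ : absoluteGaloisGroup F) (a : LTCoeff F) :
    (frobUnitBall E σ₀ : unitBall E →+* unitBall E) (algebraMap (LTCoeff F) (unitBall E) a) =
      algebraMap (LTCoeff F) (unitBall E) a :=
  unitBallEquiv_algebraMap E _ ((LTCoeff.of F).symm a)

/-- ★ **`𝒮_E(δβ) = π · (δβ)^φ`** (the twisted eigen-equation; de Shalit Cor. I.3.12 over the unramified base).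
[cite: deShalit1987, Ch. I §3.12 Corollary] -/
theorem relTraceTwo_relLogDerivSeries (β : RelNormCoherentUnits hπ E) :
    relTraceTwo hπ E hq (relLogDerivSeries hπ E hq hE hσ₀ β) =
      PowerSeries.C (algebraMap 𝒪[F] (unitBall E) π) *
        PowerSeries.map (frobUnitBall E σ₀ : unitBall E →+* unitBall E) (relLogDerivSeries hπ E hq hE hσ₀ β) :=
  relTraceTwo_relLogDeriv_of_relNormTwo_eq_map hπ E hq (frobUnitBall_algebraMap_LTCoeff E σ₀) _
    (relNormTwo_relColemanSeries hπ E hq hE hσ₀ β)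

/-- **`δ(ββ') = δβ + δβ'`** (`g_{ββ'} = g_β g_{β'}` and `δ_E` is a homomorphism). [cite: deShalit1987, Ch. I §3.4 Lemma (i)] -/
theorem relLogDerivSeries_mul (β β' : RelNormCoherentUnits hπ E) :
    relLogDerivSeries hπ E hq hE hσ₀ (β.mul β') =
      relLogDerivSeries hπ E hq hE hσ₀ β + relLogDerivSeries hπ E hq hE hσ₀ β' := by
  rw [relLogDerivSeries, relLogDerivSeries, relLogDerivSeries, ← relLogDeriv_mul]
  congr 1
  exact Units.ext (by simp [relColemanSeries_mul])

/-- `δ 1 = 0`. [cite: deShalit1987, Ch. I §3.4 Lemma (i)] -/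
theorem relLogDerivSeries_one :
    relLogDerivSeries hπ E hq hE hσ₀ (RelNormCoherentUnits.one : RelNormCoherentUnits hπ E) = 0 := by
  rw [relLogDerivSeries, ← relLogDeriv_one hπ E]
  congr 1
  exact Units.ext (by simp [relColemanSeries_one])

/-! ### The twisted tilde `(δβ)~ = δβ − u·((δβ)^φ ∘ f)` and the coordinate `r_β` -/

/-- **`(δβ)~ := δβ − u·((δβ)^φ ∘ f)`** (`π = 2u`). [cite: deShalit1987, Ch. I §3.13] -/
def relTildeSeries (u : LTCoeff F) (β : RelNormCoherentUnits hπ E) : PowerSeries (unitBall E) :=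
  relLogDerivSeries hπ E hq hE hσ₀ β - PowerSeries.C (algebraMap (LTCoeff F) (unitBall E) u) *
    PowerSeries.subst ((ltSer F π).map (algebraMap (LTCoeff F) (unitBall E)))
      (PowerSeries.map (frobUnitBall E σ₀ : unitBall E →+* unitBall E) (relLogDerivSeries hπ E hq hE hσ₀ β))

/-- ★ **`𝒮_E((δβ)~) = 0`.** [cite: deShalit1987, Ch. I §3.13] -/
theorem relTraceTwo_relTildeSeries {u : LTCoeff F} (hu : LTCoeff.of F π = residueFieldCard F * u) (β : RelNormCoherentUnits hπ E) :
    relTraceTwo hπ E hq (relTildeSeries hπ E hq hE hσ₀ u β) = 0 :=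
  relTraceTwo_twistedTilde_eq_zero hπ E hq hu _ (relTraceTwo_relLogDerivSeries hπ E hq hE hσ₀ β)

/-- `(δβ)~` is additive in `β`. [cite: deShalit1987, Ch. I §3.4 Lemma (i)] -/
theorem relTildeSeries_mul (u : LTCoeff F) (β β' : RelNormCoherentUnits hπ E) :
    relTildeSeries hπ E hq hE hσ₀ u (β.mul β') = relTildeSeries hπ E hq hE hσ₀ u β + relTildeSeries hπ E hq hE hσ₀ u β' := by
  have hs : PowerSeries.HasSubst ((ltSer F π).map (algebraMap (LTCoeff F) (unitBall E))) :=
    PowerSeries.HasSubst.of_constantCoeff_zero' ((isLTSeries_ltSer π).map _).constantCoeff_eq_zero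
  rw [relTildeSeries, relTildeSeries, relTildeSeries, relLogDerivSeries_mul, map_add, ← PowerSeries.coe_substAlgHom hs, map_add]
  ring

omit [Normal F E] [IsGalois F E] in
/-- `(H ∘ f)(0) = H(0)` for `H ∈ 𝒪_E⟦X⟧` (`f(0) = 0`; evaluate at the point `0`). [cite: deShalit1987, Ch. I §3.13 (proof)] -/
theorem constantCoeff_subst_map_ltSer (H : PowerSeries (unitBall E)) :
    PowerSeries.constantCoeff (PowerSeries.subst ((ltSer F π).map (algebraMap (LTCoeff F) (unitBall E))) H) =
      PowerSeries.constantCoeff H := by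
  have hf0 : PowerSeries.constantCoeff ((ltSer F π).map (algebraMap (LTCoeff F) (unitBall E))) = 0 :=
    ((isLTSeries_ltSer π).map _).constantCoeff_eq_zero
  rw [← evS_zero_eq (maxNilIdeal F E), evS_subst (maxNilIdeal F E) 0 hf0, ← evS_zero_eq (maxNilIdeal F E) H]
  congr 2
  apply Subtype.ext
  change evS (maxNilIdeal F E) 0 _ = ((0 : (maxNilIdeal F E).toIdeal) : unitBall E)
  rw [evS_zero_eq, hf0, ZeroMemClass.coe_zero]

/-- **`(δβ)~(0) = (δβ)(0) − u·φ((δβ)(0))`**: the constant term of the coordinate side is the image of `(δβ)(0)` under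
the relative anomaly map `c ↦ c − u·φ(c)` of `𝒪_E` (de Shalit I §3.7: cokernel `(𝒪_{k'}/p^N)(1)`). [cite: deShalit1987, Ch. I §3.7] -/
theorem constantCoeff_relTildeSeries (u : LTCoeff F) (β : RelNormCoherentUnits hπ E) :
    PowerSeries.constantCoeff (relTildeSeries hπ E hq hE hσ₀ u β) =
      PowerSeries.constantCoeff (relLogDerivSeries hπ E hq hE hσ₀ β) -
        algebraMap (LTCoeff F) (unitBall E) u *
          (frobUnitBall E σ₀ : unitBall E →+* unitBall E) (PowerSeries.constantCoeff (relLogDerivSeries hπ E hq hE hσ₀ β)) := by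
  rw [relTildeSeries, map_sub, map_mul, PowerSeries.constantCoeff_C, constantCoeff_subst_map_ltSer,
    ← PowerSeries.coeff_zero_eq_constantCoeff_apply (PowerSeries.map _ _), PowerSeries.coeff_map,
    PowerSeries.coeff_zero_eq_constantCoeff_apply]

/-- ★ **The coordinate exists and is unique**: `(δβ)~ = (1 + u⁻¹X)·(r ∘ f)` for exactly one `r ∈ 𝒪_E⟦Y⟧`
(`ker 𝒮_E = (1 + u⁻¹X)·𝒪_E⟦f⟧`, free of rank one). [cite: deShalit1987, Ch. I §3.7] -/
theorem existsUnique_relCoord (u : (LTCoeff F)ˣ) (hu : LTCoeff.of F π = residueFieldCard F * u) (β : RelNormCoherentUnits hπ E) :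
    ∃! r : PowerSeries (unitBall E), relTildeSeries hπ E hq hE hσ₀ (u : LTCoeff F) β =
      (1 + PowerSeries.C (algebraMap (LTCoeff F) (unitBall E) (↑u⁻¹ : LTCoeff F)) * PowerSeries.X) *
        PowerSeries.subst ((ltSer F π).map (algebraMap (LTCoeff F) (unitBall E))) r := by
  obtain ⟨r, hr⟩ := (relTraceTwo_eq_zero_iff hπ E hq (two_eq_of_mul_inv hq u hu) _).mp
    (relTraceTwo_relTildeSeries hπ E hq hE hσ₀ hu β)
  exact ⟨r, hr, fun r' hr' => eq_of_one_add_mul_subst_eq_E hπ E hq _ (hr'.symm.trans hr)⟩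

/-- **The coordinate `r_β ∈ 𝒪_E⟦Y⟧` of `β`** (de Shalit I §3.7 over `k'`). [cite: deShalit1987, Ch. I §3.7] -/
def relUnitCoordTwo (u : (LTCoeff F)ˣ) (hu : LTCoeff.of F π = residueFieldCard F * u) (β : RelNormCoherentUnits hπ E) :
    PowerSeries (unitBall E) :=
  (existsUnique_relCoord hπ E hq hE hσ₀ u hu β).choose

/-- ★★ **`(δβ)~ = (1 + u⁻¹X) · (r_β ∘ f)`.** [cite: deShalit1987, Ch. I §3.7] -/
theorem relTildeSeries_eq_relUnitCoordTwo (u : (LTCoeff F)ˣ) (hu : LTCoeff.of F π = residueFieldCard F * u)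
    (β : RelNormCoherentUnits hπ E) :
    relTildeSeries hπ E hq hE hσ₀ (u : LTCoeff F) β =
      (1 + PowerSeries.C (algebraMap (LTCoeff F) (unitBall E) (↑u⁻¹ : LTCoeff F)) * PowerSeries.X) *
        PowerSeries.subst ((ltSer F π).map (algebraMap (LTCoeff F) (unitBall E))) (relUnitCoordTwo hπ E hq hE hσ₀ u hu β) :=
  (existsUnique_relCoord hπ E hq hE hσ₀ u hu β).choose_spec.1

/-- **Characterisation**: any `r` with `(δβ)~ = (1 + u⁻¹X)(r ∘ f)` is `r_β`. [cite: deShalit1987, Ch. I §3.7] -/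
theorem eq_relUnitCoordTwo (u : (LTCoeff F)ˣ) (hu : LTCoeff.of F π = residueFieldCard F * u)
    (β : RelNormCoherentUnits hπ E) {r : PowerSeries (unitBall E)}
    (hr : relTildeSeries hπ E hq hE hσ₀ (u : LTCoeff F) β =
      (1 + PowerSeries.C (algebraMap (LTCoeff F) (unitBall E) (↑u⁻¹ : LTCoeff F)) * PowerSeries.X) *
        PowerSeries.subst ((ltSer F π).map (algebraMap (LTCoeff F) (unitBall E))) r) :
    r = relUnitCoordTwo hπ E hq hE hσ₀ u hu β :=
  (existsUnique_relCoord hπ E hq hE hσ₀ u hu β).choose_spec.2 r hr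

/-- ★ **`r_{ββ'} = r_β + r_{β'}`**: `β ↦ r_β` is a homomorphism `𝒰 → 𝒪_E⟦Y⟧`. [cite: deShalit1987, Ch. I §3.4 Lemma (i), §3.7] -/
theorem relUnitCoordTwo_mul (u : (LTCoeff F)ˣ) (hu : LTCoeff.of F π = residueFieldCard F * u)
    (β β' : RelNormCoherentUnits hπ E) :
    relUnitCoordTwo hπ E hq hE hσ₀ u hu (β.mul β') =
      relUnitCoordTwo hπ E hq hE hσ₀ u hu β + relUnitCoordTwo hπ E hq hE hσ₀ u hu β' := by
  symm
  refine eq_relUnitCoordTwo hπ E hq hE hσ₀ u hu _ ?_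
  have hs : PowerSeries.HasSubst ((ltSer F π).map (algebraMap (LTCoeff F) (unitBall E))) :=
    PowerSeries.HasSubst.of_constantCoeff_zero' ((isLTSeries_ltSer π).map _).constantCoeff_eq_zero
  rw [relTildeSeries_mul, relTildeSeries_eq_relUnitCoordTwo hπ E hq hE hσ₀ u hu β,
    relTildeSeries_eq_relUnitCoordTwo hπ E hq hE hσ₀ u hu β', ← PowerSeries.coe_substAlgHom hs, map_add]
  ring

/-- `r_1 = 0`. [cite: deShalit1987, Ch. I §3.4 Lemma (i)] -/
theorem relUnitCoordTwo_one (u : (LTCoeff F)ˣ) (hu : LTCoeff.of F π = residueFieldCard F * u) :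
    relUnitCoordTwo hπ E hq hE hσ₀ u hu (RelNormCoherentUnits.one : RelNormCoherentUnits hπ E) = 0 := by
  symm
  refine eq_relUnitCoordTwo hπ E hq hE hσ₀ u hu _ ?_
  have hs : PowerSeries.HasSubst ((ltSer F π).map (algebraMap (LTCoeff F) (unitBall E))) :=
    PowerSeries.HasSubst.of_constantCoeff_zero' ((isLTSeries_ltSer π).map _).constantCoeff_eq_zero
  rw [relTildeSeries, relLogDerivSeries_one, map_zero, ← PowerSeries.coe_substAlgHom hs, map_zero]
  ring

end RelativeCoordTwo

end Literature.NumberTheory.GaloisRepresentations
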